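import Literature.MathematicalPhysics.QuantumLattice.ErgodicGroundStatePairLROCeiling
import HarnessLib

/-!
# `d`-wave quasi-average order ⟺ `d`-wave ODLRO of some translation-invariant ground state
# (response ⇔ long-range order in the infinite-volume translation-invariant class, unconditional)

Topic `Literature/MathematicalPhysics/QuantumLattice` (namespace = path; family `hubbard`, cell `hubbard-cq`,
seat `hubbard-cq-lit-1` g4). Notation as in `TIGroundStatePairLROCeiling.lean`:
`Ψ_0 = hubbardTTPrimeMuInteraction 1 t' U μ` (the grand-canonical `t–t'` Hubbard interaction on `ℤ²`),
`m⋆ = dWaveOrderParameterTT' t' U μ` (Koma–Tasaki's quasi-average `d`-wave order parameter),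
`P₀ = localPairAt ({0} ∪ unitSteps) dWaveFormFactor 0`, `boxavg_N(ω) = N⁻⁴ Σ_{x,y∈[0,N)²} ω(P_x⋆ P_y)`.

Everything here is PROVED (no definition, no named fact):

* `IsMeanEnergyMinimiser.eventually_norm_boxAverage_dWavePairCorr_le` — **LINEAR LRO CEILING FOR EVERY
  TRANSLATION-INVARIANT GROUND STATE**: for every translation-invariant ground state `ω` of `Ψ_0` and every
  `ε > 0`, eventually `|boxavg_N(ω)| ≤ 3(4‖P₀‖ + 1)·m⋆ + ε`. Mechanism (Bratteli–Robinson I §4.3.1 faces +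
  Thm. 4.3.17 unwound, `ErgodicStatesODLROProofs.lean` §4–§6): along a free ultrafilter the Fejér functionals
  `A ↦ lim N⁻⁴Σ_{x,y} ω(A·τ_{y−x}B)` (`B` even, `0 ⪯ B ⪯ 𝟙`) are `ω(B)`, `1 − ω(B)` times translation-invariant
  states `ψ_B`, `ψ_{𝟙−B}` whose mixture is `ω` (`mix_eq_of_limitStates`); the ground states form a FACE, so
  `ψ_B` is again a ground state and `|ψ_B(P₀)| ≤ m⋆` (`DWaveSymmetricGroundStateLRO.lean`); linearity in `B`
  and `B = P₀ = H₁ + iH₂` give the bound along every ultrafilter, hence eventually.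
* `IsMeanEnergyMinimiser.tendsto_boxAverage_dWavePairCorr_of_not_hasDWaveOrderTT'` — **no response ⇒ no ODLRO**:
  if `m⋆ = 0`, EVERY translation-invariant ground state has `boxavg_N(ω) → 0`.
* **`hasDWaveOrderTT'_iff_exists_isMeanEnergyMinimiser_odlro`** — `m⋆ > 0` iff SOME translation-invariant ground
  state of `Ψ_0` has `d`-wave off-diagonal long-range order (`∃ c > 0`, eventually `Re boxavg_N(ω) ≥ c`); the
  forward direction is Koma–Tasaki's quasi-average ground state (`DWaveSymmetricGroundStateLRO.lean`, box LRO
  `≥ (m⋆)²` for a gauge-invariant ground state), the backward direction is the linear ceiling.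

This is the infinite-volume form of Koma–Tasaki's «LRO ⇒ symmetry breaking» (J. Stat. Phys. 76 (1994) §2.5,
`μ₁ ≥ μ₂`-type statements; CMP 158 (1993) Thm. 7.3) for the `d`-wave pair field of the `t–t'` Hubbard model,
with the converse, in the class of translation-invariant infinite-volume ground states. The quadratic ceiling
`limsup boxavg ≤ (m⋆)²` for non-ergodic ground states (`TIGroundStatePairLROCeiling`) is NOT claimed (it holds on
ergodic ground states, `ErgodicGroundStatePairLROCeiling.lean`).

HONEST SCOPE: T5-class (infinite-volume translation-invariant ground states); nothing about torus ground states
(cell census [U] ∧ [BN7] untouched); no number, no CQ row, not a floor instrument.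

## References
* O. Bratteli, D. W. Robinson, *Operator Algebras and Quantum Statistical Mechanics 1*, 2nd ed. (1987), §4.3.1
  (faces of `E^G`, ergodic states; PDF p. 373), Thm. 4.3.17 (PDF p. 395). [cite: BratteliRobinsonI1987, Thm. 4.3.17]
* T. Koma, H. Tasaki, J. Stat. Phys. 76 (1994) 745, §1 and §2.5. [cite: KomaTasaki1994, §2.5]
* T. Koma, H. Tasaki, Commun. Math. Phys. 158 (1993) 191, Thm. 7.3. [cite: KomaTasaki1993, Theorem 7.3]
-/

noncomputable section

namespace Literature.MathematicalPhysics.QuantumLattice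

open _root_.Matrix Finset Complex Literature.Probability.LatticeModels _root_.Filter Set
open scoped _root_.Topology ComplexOrder

/-! ### Ultrafilter plumbing -/

/-- A bounded complex sequence converges along every ultrafilter to its `limUnder`. [folklore] -/
private theorem tendsto_limUnder_of_norm_le' {s : ℕ → ℂ} {R : ℝ} (𝒰 : Ultrafilter ℕ)
    (hs : ∀ n, ‖s n‖ ≤ R) : Tendsto s (𝒰 : Filter ℕ) (𝓝 (limUnder (𝒰 : Filter ℕ) s)) := by
  refine tendsto_nhds_limUnder ?_
  have hle : (↑(Ultrafilter.map s 𝒰) : Filter ℂ) ≤ 𝓟 (Metric.closedBall (0 : ℂ) R) := by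
    rw [Ultrafilter.coe_map, le_principal_iff]
    exact mem_map.2 (Filter.Eventually.of_forall fun n => by simpa using hs n)
  obtain ⟨x, -, hx⟩ := (isCompact_closedBall (0 : ℂ) R).ultrafilter_le_nhds _ hle
  exact ⟨x, by rwa [Ultrafilter.coe_map] at hx⟩

/-- **From ultrafilter limits to an eventual bound**: if every ultrafilter limit of a bounded sequence has norm
`≤ K`, then for every `ε > 0` eventually `‖s_N‖ ≤ K + ε` (otherwise an ultrafilter refining the exceptional set
would have a limit of norm `≥ K + ε`). [folklore] -/
private theorem eventually_norm_le_of_forall_ultrafilter {s : ℕ → ℂ} {R K : ℝ} (hs : ∀ n, ‖s n‖ ≤ R)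
    (h : ∀ 𝒰 : Ultrafilter ℕ, (𝒰 : Filter ℕ) ≤ atTop → ‖limUnder (𝒰 : Filter ℕ) s‖ ≤ K) {ε : ℝ}
    (hε : 0 < ε) : ∀ᶠ N : ℕ in atTop, ‖s N‖ ≤ K + ε := by
  by_contra hnot
  have hfreq : ∃ᶠ N : ℕ in atTop, K + ε < ‖s N‖ := by
    rw [Filter.not_eventually] at hnot
    exact hnot.mono fun N hN => not_le.1 hN
  have hne : NeBot (atTop ⊓ 𝓟 {N : ℕ | K + ε < ‖s N‖}) :=
    (inf_principal_neBot_iff.2 fun U hU => hfreq.and_eventually hU |>.exists.imp fun N hN => ⟨hN.2, hN.1⟩)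
  set 𝒰 := Ultrafilter.of (atTop ⊓ 𝓟 {N : ℕ | K + ε < ‖s N‖}) with h𝒰
  have h𝒰le : (𝒰 : Filter ℕ) ≤ atTop ⊓ 𝓟 {N : ℕ | K + ε < ‖s N‖} := Ultrafilter.of_le _
  have hlim := tendsto_limUnder_of_norm_le' 𝒰 hs
  have hev : ∀ᶠ N in (𝒰 : Filter ℕ), K + ε ≤ ‖s N‖ :=
    (h𝒰le.trans inf_le_right) (fun N (hN : K + ε < ‖s N‖) => hN.le)
  have hge : K + ε ≤ ‖limUnder (𝒰 : Filter ℕ) s‖ :=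
    isClosed_Ici.mem_of_tendsto ((continuous_norm.tendsto _).comp hlim) hev
  linarith [h 𝒰 (h𝒰le.trans inf_le_left)]

section LoewnerNorm

open scoped MatrixOrder Matrix.Norms.L2Operator

variable {n : Type*} [Fintype n] [DecidableEq n]

/-- `K ≤ ‖K‖·𝟙` for a Hermitian matrix (Loewner order, L²-operator norm). [folklore] -/
private theorem posSemidef_norm_smul_one_sub' {K : Matrix n n ℂ} (hK : K.IsHermitian) :
    ((‖K‖ : ℂ) • (1 : Matrix n n ℂ) - K).PosSemidef := by
  letI : CStarAlgebra (Matrix n n ℂ) := {}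
  have hsa : IsSelfAdjoint K := hK
  have h := IsSelfAdjoint.le_algebraMap_norm_self hsa
  rw [Algebra.algebraMap_eq_smul_one] at h
  rw [← Matrix.nonneg_iff_posSemidef, sub_nonneg]
  convert h using 1
  ext i j
  simp [Matrix.smul_apply, Matrix.one_apply]

/-- `-‖K‖·𝟙 ≤ K` for a Hermitian matrix (Loewner order, L²-operator norm). [folklore] -/
private theorem posSemidef_norm_smul_one_add' {K : Matrix n n ℂ} (hK : K.IsHermitian) :
    ((‖K‖ : ℂ) • (1 : Matrix n n ℂ) + K).PosSemidef := by
  letI : CStarAlgebra (Matrix n n ℂ) := {}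
  have hsa : IsSelfAdjoint K := hK
  have h := IsSelfAdjoint.neg_algebraMap_norm_le_self hsa
  rw [Algebra.algebraMap_eq_smul_one] at h
  rw [← Matrix.nonneg_iff_posSemidef, ← sub_nonneg] at *
  convert h using 1
  rw [sub_neg_eq_add, add_comm]
  ext i j
  simp [Matrix.smul_apply, Matrix.one_apply]

end LoewnerNorm

namespace InfVolFermionState

/-! ### The two limit states of a translation-invariant state decompose it -/

/-- **The limit states of the Fejér functionals of `B` and `𝟙 − B` are the halves of a convex decomposition of
`ω`**: if `φ¹_N + φ²_N = ω` eventually and `ψ_j = m_j⁻¹ lim_𝒰 φʲ_N` (`m₁ + m₂ = 1`), then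
`m₁ ψ₁ + m₂ ψ₂ = ω`. [cite: BratteliRobinsonI1987, §4.3.1 (PDF p. 373)] -/
theorem mix_eq_of_limitStates {d : ℕ} {ω : InfVolFermionState d}
    {φ₁ φ₂ : ℕ → (Λ : Finset (Site d)) → FermionOp Λ → ℂ} {m₁ m₂ : ℝ} (hm₁ : 0 < m₁) (hm₂ : 0 < m₂)
    (hm : m₁ + m₂ = 1) {𝒰 : Ultrafilter ℕ} (h𝒰 : (𝒰 : Filter ℕ) ≤ atTop) {ψ₁ ψ₂ : InfVolFermionState d}
    (hψ₁ : ∀ Λ (A : FermionOp Λ), ψ₁.expect Λ A = (m₁ : ℂ)⁻¹ * limUnder (𝒰 : Filter ℕ) (fun N => φ₁ N Λ A))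
    (hψ₂ : ∀ Λ (A : FermionOp Λ), ψ₂.expect Λ A = (m₂ : ℂ)⁻¹ * limUnder (𝒰 : Filter ℕ) (fun N => φ₂ N Λ A))
    (hbdd₁ : ∀ Λ (A : FermionOp Λ), ∃ R : ℝ, ∀ N, ‖φ₁ N Λ A‖ ≤ R)
    (hbdd₂ : ∀ Λ (A : FermionOp Λ), ∃ R : ℝ, ∀ N, ‖φ₂ N Λ A‖ ≤ R)
    (hsum : ∀ Λ (A : FermionOp Λ), ∀ᶠ N in atTop, φ₁ N Λ A + φ₂ N Λ A = ω.expect Λ A) :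
    mix m₁ hm₁.le (by linarith) ψ₁ ψ₂ = ω := by
  have hm₁0 : (m₁ : ℂ) ≠ 0 := Complex.ofReal_ne_zero.2 hm₁.ne'
  have hm₂0 : (m₂ : ℂ) ≠ 0 := Complex.ofReal_ne_zero.2 hm₂.ne'
  refine InfVolFermionState.ext fun Λ => LinearMap.ext fun A => ?_
  obtain ⟨R₁, hR₁⟩ := hbdd₁ Λ A
  obtain ⟨R₂, hR₂⟩ := hbdd₂ Λ A
  have ha := (tendsto_limUnder_of_norm_le' 𝒰 hR₁).add (tendsto_limUnder_of_norm_le' 𝒰 hR₂)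
  have hb : Tendsto (fun N => φ₁ N Λ A + φ₂ N Λ A) (𝒰 : Filter ℕ) (𝓝 (ω.expect Λ A)) :=
    tendsto_const_nhds.congr' (((hsum Λ A).filter_mono h𝒰).mono fun N hN => hN.symm)
  rw [mix_expect, hψ₁, hψ₂, ← tendsto_nhds_unique ha hb, show (1 - m₁ : ℝ) = m₂ by linarith,
    mul_inv_cancel_left₀ hm₁0, mul_inv_cancel_left₀ hm₂0]

/-! ### Box-pair sums: linearity in the translated observable (re-derived; file-local) -/

section BoxPair

variable {d : ℕ} (ω : InfVolFermionState d) {Λ X : Finset (Site d)}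

/-- Additivity of the box-pair sums in the translated observable. [folklore] -/
private theorem corr_shift_add (N : ℕ) (A : FermionOp Λ) (B B' : FermionOp X) :
    ∑ x ∈ halfOpenBox d N, ∑ y ∈ halfOpenBox d N,
        ω.corr A (fermionEmbed (PolySite.shiftEmb (y - x) X) (B + B')) =
      ∑ x ∈ halfOpenBox d N, ∑ y ∈ halfOpenBox d N,
          ω.corr A (fermionEmbed (PolySite.shiftEmb (y - x) X) B) +
        ∑ x ∈ halfOpenBox d N, ∑ y ∈ halfOpenBox d N,
          ω.corr A (fermionEmbed (PolySite.shiftEmb (y - x) X) B') := by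
  simp_rw [map_add, corr_add_right, sum_add_distrib]

/-- Homogeneity of the box-pair sums in the translated observable. [folklore] -/
private theorem corr_shift_smul (N : ℕ) (c : ℂ) (A : FermionOp Λ) (B : FermionOp X) :
    ∑ x ∈ halfOpenBox d N, ∑ y ∈ halfOpenBox d N,
        ω.corr A (fermionEmbed (PolySite.shiftEmb (y - x) X) (c • B)) =
      c * ∑ x ∈ halfOpenBox d N, ∑ y ∈ halfOpenBox d N,
        ω.corr A (fermionEmbed (PolySite.shiftEmb (y - x) X) B) := by
  simp_rw [map_smul, corr_smul_right, mul_sum]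

/-- Subtractivity of the box-pair sums in the translated observable. [folklore] -/
private theorem corr_shift_sub (N : ℕ) (A : FermionOp Λ) (B B' : FermionOp X) :
    ∑ x ∈ halfOpenBox d N, ∑ y ∈ halfOpenBox d N,
        ω.corr A (fermionEmbed (PolySite.shiftEmb (y - x) X) (B - B')) =
      ∑ x ∈ halfOpenBox d N, ∑ y ∈ halfOpenBox d N,
          ω.corr A (fermionEmbed (PolySite.shiftEmb (y - x) X) B) -
        ∑ x ∈ halfOpenBox d N, ∑ y ∈ halfOpenBox d N,
          ω.corr A (fermionEmbed (PolySite.shiftEmb (y - x) X) B') := by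
  simp_rw [map_sub, corr_sub_right, sum_sub_distrib]

/-- The box-pair sums against the unit: `N^{2d} ω(A)`. [folklore] -/
private theorem corr_shift_one (N : ℕ) (A : FermionOp Λ) :
    ∑ x ∈ halfOpenBox d N, ∑ y ∈ halfOpenBox d N,
        ω.corr A (fermionEmbed (PolySite.shiftEmb (y - x) X) (1 : FermionOp X)) =
      ((N : ℂ) ^ d) ^ 2 * ω.expect Λ A := by
  simp_rw [map_one, corr_one_right, sum_const, card_halfOpenBox, nsmul_eq_mul]
  push_cast
  ring

end BoxPair

/-! ### The Fejér limits of a ground state against `P₀⋆` are bounded by `m⋆` -/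

section Ceiling

open scoped Matrix.Norms.L2Operator

variable {t' U μ : ℝ}

/-- The pair amplitude of `P₀⋆` in a ground state is bounded by `m⋆` (conjugate of the `P₀` amplitude).
[cite: KomaTasaki1994, §1] -/
theorem IsMeanEnergyMinimiser.norm_expect_localPairAt_conjTranspose_le {ω : InfVolFermionState 2}
    (hω : ω.IsMeanEnergyMinimiser (hubbardTTPrimeMuInteraction 1 t' U μ) 1) :
    ‖ω.expect (pairRegion (insert (0 : Site 2) unitSteps) 0)
        (localPairAt (insert 0 unitSteps) dWaveFormFactor 0)ᴴ‖ ≤ dWaveOrderParameterTT' t' U μ := by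
  rw [expect_conjTranspose, norm_star]
  exact hω.norm_expect_localPairAt_le_dWaveOrderParameterTT' t' U μ

/-- **Step 1 (order-restricted).** For a translation-invariant GROUND STATE `ω` of `Ψ_0`, an even `B` with
`0 ⪯ B ⪯ 𝟙` and `0 < ω(B) < 1`, and every ultrafilter `𝒰 ≥ atTop`:
`‖lim_𝒰 N⁻⁴Σ_{x,y} ω(P₀⋆ · τ_{y−x} B)‖ ≤ m⋆` — the limit is `ω(B) ψ_B(P₀⋆)` with `ψ_B` a translation-invariant
GROUND STATE (face property of the mean-energy minimisers), and `|ψ_B(P₀)| ≤ m⋆`.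
[cite: BratteliRobinsonI1987, §4.3.1 (PDF p. 373)] -/
theorem IsMeanEnergyMinimiser.norm_limUnder_boxPairAverage_le_of_posSemidef {ω : InfVolFermionState 2}
    (hω : ω.IsMeanEnergyMinimiser (hubbardTTPrimeMuInteraction 1 t' U μ) 1) {X : Finset (Site 2)}
    {B : FermionOp X} (hB : parityAut B = B) (hB0 : B.PosSemidef) (hB1 : (1 - B).PosSemidef)
    (hω0 : 0 < (ω.expect X B).re) (hω1 : (ω.expect X B).re < 1) {𝒰 : Ultrafilter ℕ}
    (h𝒰 : (𝒰 : Filter ℕ) ≤ atTop) :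
    ‖limUnder (𝒰 : Filter ℕ) (fun N => (((N : ℂ) ^ 2) ^ 2)⁻¹ *
        ∑ x ∈ halfOpenBox 2 N, ∑ y ∈ halfOpenBox 2 N,
          ω.corr (localPairAt (insert (0 : Site 2) unitSteps) dWaveFormFactor 0)ᴴ
            (fermionEmbed (PolySite.shiftEmb (y - x) X) B))‖ ≤ dWaveOrderParameterTT' t' U μ := by
  classical
  have hωTI := hω.1
  set m₁ : ℝ := (ω.expect X B).re with hm₁
  have hmB : ω.expect X B = (m₁ : ℂ) :=
    Complex.ext (by rw [Complex.ofReal_re]) (by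
      rw [Complex.ofReal_im]; exact ω.expect_im_eq_zero_of_isHermitian hB0.1)
  have hB' : parityAut (1 - B) = 1 - B := by rw [map_sub, map_one, hB]
  have hmB' : ω.expect X (1 - B) = ((1 - m₁ : ℝ) : ℂ) := by
    rw [map_sub, ω.expect_one, hmB]; push_cast; ring
  obtain ⟨ψ₁, hψ₁TI, hψ₁e⟩ :=
    hωTI.exists_limitState_boxPairAverage (by norm_num : 0 < 2) hB hB0 hω0 hmB 𝒰 h𝒰
  obtain ⟨ψ₂, hψ₂TI, hψ₂e⟩ :=
    hωTI.exists_limitState_boxPairAverage (by norm_num : 0 < 2) hB' hB1 (by linarith : 0 < 1 - m₁) hmB' 𝒰 h𝒰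
  -- the two limit states decompose `ω`
  have hmix : InfVolFermionState.mix m₁ hω0.le (by linarith) ψ₁ ψ₂ = ω := by
    refine mix_eq_of_limitStates hω0 (by linarith : 0 < 1 - m₁) (by ring) h𝒰 hψ₁e hψ₂e
      (fun Λ A => ⟨‖A‖ * ‖B‖, fun N => ω.norm_boxPairAverage_le N A B⟩)
      (fun Λ A => ⟨‖A‖ * ‖1 - B‖, fun N => ω.norm_boxPairAverage_le N A (1 - B)⟩) ?_
    intro Λ A
    filter_upwards [eventually_ne_atTop 0] with N hN
    have hc : ((N : ℂ) ^ 2) ^ 2 ≠ 0 := pow_ne_zero _ (pow_ne_zero _ (Nat.cast_ne_zero.2 hN))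
    rw [← mul_add, corr_shift_sub, add_sub_cancel, corr_shift_one, ← mul_assoc, inv_mul_cancel₀ hc, one_mul]
  -- `ψ₁` is a ground state (face property)
  have hψ₁gs : ψ₁.IsMeanEnergyMinimiser (hubbardTTPrimeMuInteraction 1 t' U μ) 1 :=
    IsMeanEnergyMinimiser.of_mix_left hω0 hψ₁TI hψ₂TI (hmix.symm ▸ hω)
  -- the limit is `m₁ ψ₁(P₀⋆)`
  have hm₁0 : (m₁ : ℂ) ≠ 0 := Complex.ofReal_ne_zero.2 hω0.ne'
  have hlim : limUnder (𝒰 : Filter ℕ) (fun N => (((N : ℂ) ^ 2) ^ 2)⁻¹ *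
      ∑ x ∈ halfOpenBox 2 N, ∑ y ∈ halfOpenBox 2 N,
        ω.corr (localPairAt (insert (0 : Site 2) unitSteps) dWaveFormFactor 0)ᴴ
          (fermionEmbed (PolySite.shiftEmb (y - x) X) B)) =
      (m₁ : ℂ) * ψ₁.expect _ (localPairAt (insert (0 : Site 2) unitSteps) dWaveFormFactor 0)ᴴ := by
    rw [hψ₁e, mul_inv_cancel_left₀ hm₁0]
  rw [hlim, norm_mul, Complex.norm_real, Real.norm_eq_abs, abs_of_pos hω0]
  calc m₁ * ‖ψ₁.expect _ (localPairAt (insert (0 : Site 2) unitSteps) dWaveFormFactor 0)ᴴ‖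
      ≤ 1 * dWaveOrderParameterTT' t' U μ :=
        mul_le_mul hω1.le hψ₁gs.norm_expect_localPairAt_conjTranspose_le (norm_nonneg _) zero_le_one
    _ = dWaveOrderParameterTT' t' U μ := one_mul _

/-- **Step 2 (Hermitian).** For an even Hermitian `H` and a ground state `ω`:
`‖lim_𝒰 N⁻⁴Σ ω(P₀⋆ · τ_{y−x} H)‖ ≤ (3/2)(4‖H‖ + 1)·m⋆` (apply Step 1 to `B' = ½𝟙 + (4‖H‖+1)⁻¹ H`).
[cite: BratteliRobinsonI1987, §4.3.1 (PDF p. 373)] -/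
theorem IsMeanEnergyMinimiser.norm_limUnder_boxPairAverage_le_of_isHermitian {ω : InfVolFermionState 2}
    (hω : ω.IsMeanEnergyMinimiser (hubbardTTPrimeMuInteraction 1 t' U μ) 1) {X : Finset (Site 2)}
    {H : FermionOp X} (hH : parityAut H = H) (hHh : H.IsHermitian) {𝒰 : Ultrafilter ℕ}
    (h𝒰 : (𝒰 : Filter ℕ) ≤ atTop) :
    ‖limUnder (𝒰 : Filter ℕ) (fun N => (((N : ℂ) ^ 2) ^ 2)⁻¹ *
        ∑ x ∈ halfOpenBox 2 N, ∑ y ∈ halfOpenBox 2 N,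
          ω.corr (localPairAt (insert (0 : Site 2) unitSteps) dWaveFormFactor 0)ᴴ
            (fermionEmbed (PolySite.shiftEmb (y - x) X) H))‖ ≤
      3 / 2 * (4 * ‖H‖ + 1) * dWaveOrderParameterTT' t' U μ := by
  classical
  set A : FermionOp (pairRegion (insert (0 : Site 2) unitSteps) 0) :=
    (localPairAt (insert (0 : Site 2) unitSteps) dWaveFormFactor 0)ᴴ with hA
  -- the rescaled observable
  set r : ℝ := (4 * ‖H‖ + 1)⁻¹ with hr
  have hr0 : 0 < r := by rw [hr]; positivity
  have hrC : (r : ℂ) ≠ 0 := Complex.ofReal_ne_zero.2 hr0.ne'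
  set K : FermionOp X := (r : ℂ) • H with hK
  have hKh : K.IsHermitian := hHh.smul (by rw [IsSelfAdjoint, Complex.star_def, Complex.conj_ofReal])
  have hKn : ‖K‖ ≤ 1 / 4 := by
    rw [hK, norm_smul, Complex.norm_real, Real.norm_eq_abs, abs_of_pos hr0, hr]
    rw [inv_mul_le_iff₀ (by positivity)]
    linarith [norm_nonneg H]
  set B' : FermionOp X := ((1 / 2 : ℝ) : ℂ) • (1 : FermionOp X) + K with hB'
  have hB'even : parityAut B' = B' := by
    rw [hB', map_add, map_smul, map_one, hK, map_smul, hH]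
  have hdec1 : B' = ((1 / 2 - ‖K‖ : ℝ) : ℂ) • (1 : FermionOp X) + ((‖K‖ : ℂ) • 1 + K) := by
    rw [hB']
    push_cast
    module
  have hdec2 : 1 - B' = ((1 / 2 - ‖K‖ : ℝ) : ℂ) • (1 : FermionOp X) + ((‖K‖ : ℂ) • 1 - K) := by
    rw [hB']
    push_cast
    module
  have hcoef : (0 : ℂ) ≤ ((1 / 2 - ‖K‖ : ℝ) : ℂ) := Complex.zero_le_real.2 (by linarith)
  -- Loewner bounds `-‖K‖ ≤ K ≤ ‖K‖`
  have hKup : ((‖K‖ : ℂ) • (1 : FermionOp X) - K).PosSemidef := posSemidef_norm_smul_one_sub' hKh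
  have hKlo : ((‖K‖ : ℂ) • (1 : FermionOp X) + K).PosSemidef := posSemidef_norm_smul_one_add' hKh
  have hB'0 : B'.PosSemidef := by
    rw [hdec1]; exact (Matrix.PosSemidef.one.smul hcoef).add hKlo
  have hB'1 : (1 - B').PosSemidef := by
    rw [hdec2]; exact (Matrix.PosSemidef.one.smul hcoef).add hKup
  have hωB' : ω.expect X B' = (1 / 2 : ℂ) + (r : ℂ) * ω.expect X H := by
    rw [hB', map_add, map_smul, ω.expect_one, hK, map_smul, smul_eq_mul, mul_one, smul_eq_mul]
    push_cast
    ring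
  have hωK : ‖(r : ℂ) * ω.expect X H‖ ≤ 1 / 4 := by
    have h := ω.norm_expect_le X K
    rw [hK, map_smul, smul_eq_mul] at h
    exact h.trans hKn
  have hre : (ω.expect X B').re = 1 / 2 + ((r : ℂ) * ω.expect X H).re := by
    rw [hωB', Complex.add_re]; norm_num
  have habs := (Complex.abs_re_le_norm ((r : ℂ) * ω.expect X H)).trans hωK
  have hω0 : 0 < (ω.expect X B').re := by
    rw [hre]; linarith [neg_abs_le ((r : ℂ) * ω.expect X H).re]
  have hω1 : (ω.expect X B').re < 1 := by
    rw [hre]; linarith [le_abs_self ((r : ℂ) * ω.expect X H).re]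
  -- Step 1 for `B'`, and the constant functional for `𝟙`
  have h1 := hω.norm_limUnder_boxPairAverage_le_of_posSemidef hB'even hB'0 hB'1 hω0 hω1 h𝒰
  have hLB' := tendsto_limUnder_of_norm_le' 𝒰 (fun N => ω.norm_boxPairAverage_le N A B')
  have hL1 : Tendsto (fun N : ℕ => (((N : ℂ) ^ 2) ^ 2)⁻¹ *
      ∑ x ∈ halfOpenBox 2 N, ∑ y ∈ halfOpenBox 2 N,
        ω.corr A (fermionEmbed (PolySite.shiftEmb (y - x) X) (1 : FermionOp X))) (𝒰 : Filter ℕ)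
      (𝓝 (ω.expect _ A)) := by
    refine (tendsto_const_nhds.mono_left h𝒰).congr' ?_
    filter_upwards [h𝒰 (eventually_ne_atTop 0)] with N hN
    have hc : ((N : ℂ) ^ 2) ^ 2 ≠ 0 := pow_ne_zero _ (pow_ne_zero _ (Nat.cast_ne_zero.2 hN))
    rw [corr_shift_one, ← mul_assoc, inv_mul_cancel₀ hc, one_mul]
  -- linearity: `S(H) = r⁻¹ (S(B') − ½ S(𝟙))`
  have key : ∀ N : ℕ, (((N : ℂ) ^ 2) ^ 2)⁻¹ *
      ∑ x ∈ halfOpenBox 2 N, ∑ y ∈ halfOpenBox 2 N,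
        ω.corr A (fermionEmbed (PolySite.shiftEmb (y - x) X) H) =
      (r : ℂ)⁻¹ * ((((N : ℂ) ^ 2) ^ 2)⁻¹ *
        ∑ x ∈ halfOpenBox 2 N, ∑ y ∈ halfOpenBox 2 N,
          ω.corr A (fermionEmbed (PolySite.shiftEmb (y - x) X) B') -
        (1 / 2 : ℂ) * ((((N : ℂ) ^ 2) ^ 2)⁻¹ *
          ∑ x ∈ halfOpenBox 2 N, ∑ y ∈ halfOpenBox 2 N,
            ω.corr A (fermionEmbed (PolySite.shiftEmb (y - x) X) (1 : FermionOp X)))) := by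
    intro N
    rw [hB', corr_shift_add, corr_shift_smul, hK, corr_shift_smul]
    push_cast
    field_simp
    ring
  have hlimH : Tendsto (fun N : ℕ => (((N : ℂ) ^ 2) ^ 2)⁻¹ *
      ∑ x ∈ halfOpenBox 2 N, ∑ y ∈ halfOpenBox 2 N,
        ω.corr A (fermionEmbed (PolySite.shiftEmb (y - x) X) H)) (𝒰 : Filter ℕ)
      (𝓝 ((r : ℂ)⁻¹ * (limUnder (𝒰 : Filter ℕ) (fun N => (((N : ℂ) ^ 2) ^ 2)⁻¹ *
        ∑ x ∈ halfOpenBox 2 N, ∑ y ∈ halfOpenBox 2 N,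
          ω.corr A (fermionEmbed (PolySite.shiftEmb (y - x) X) B')) - (1 / 2 : ℂ) * ω.expect _ A))) :=
    ((hLB'.sub (hL1.const_mul (1 / 2 : ℂ))).const_mul (r : ℂ)⁻¹).congr fun N => (key N).symm
  rw [hlimH.limUnder_eq, norm_mul, norm_inv, Complex.norm_real, Real.norm_eq_abs, abs_of_pos hr0, hr, inv_inv]
  have hA' : ‖ω.expect _ A‖ ≤ dWaveOrderParameterTT' t' U μ := hω.norm_expect_localPairAt_conjTranspose_le
  have hm0 := dWaveOrderParameterTT'_nonneg t' U μ
  calc (4 * ‖H‖ + 1) * ‖limUnder (𝒰 : Filter ℕ) (fun N => (((N : ℂ) ^ 2) ^ 2)⁻¹ *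
          ∑ x ∈ halfOpenBox 2 N, ∑ y ∈ halfOpenBox 2 N,
            ω.corr A (fermionEmbed (PolySite.shiftEmb (y - x) X) B')) - (1 / 2 : ℂ) * ω.expect _ A‖
      ≤ (4 * ‖H‖ + 1) * (dWaveOrderParameterTT' t' U μ + 1 / 2 * dWaveOrderParameterTT' t' U μ) := by
        refine mul_le_mul_of_nonneg_left ((norm_sub_le _ _).trans (add_le_add h1 ?_)) (by positivity)
        rw [norm_mul]
        exact mul_le_mul (by norm_num) hA' (norm_nonneg _) (by norm_num)
    _ = 3 / 2 * (4 * ‖H‖ + 1) * dWaveOrderParameterTT' t' U μ := by ring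

/-- **Step 3 (the pair operator).** For a ground state `ω` and every ultrafilter `𝒰 ≥ atTop`,
`‖lim_𝒰 N⁻⁴Σ_{x,y} ω(P₀⋆ · τ_{y−x} P₀)‖ ≤ 3(4‖P₀‖ + 1)·m⋆` (`P₀ = H₁ + iH₂`, `‖H_j‖ ≤ ‖P₀‖`).
[cite: BratteliRobinsonI1987, §4.3.1 (PDF p. 373)] -/
theorem IsMeanEnergyMinimiser.norm_limUnder_boxPairAverage_localPairAt_le {ω : InfVolFermionState 2}
    (hω : ω.IsMeanEnergyMinimiser (hubbardTTPrimeMuInteraction 1 t' U μ) 1) {𝒰 : Ultrafilter ℕ}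
    (h𝒰 : (𝒰 : Filter ℕ) ≤ atTop) :
    ‖limUnder (𝒰 : Filter ℕ) (fun N => (((N : ℂ) ^ 2) ^ 2)⁻¹ *
        ∑ x ∈ halfOpenBox 2 N, ∑ y ∈ halfOpenBox 2 N,
          ω.corr (localPairAt (insert (0 : Site 2) unitSteps) dWaveFormFactor 0)ᴴ
            (fermionEmbed (PolySite.shiftEmb (y - x) (pairRegion (insert (0 : Site 2) unitSteps) 0))
              (localPairAt (insert (0 : Site 2) unitSteps) dWaveFormFactor 0)))‖ ≤
      3 * (4 * ‖localPairAt (insert (0 : Site 2) unitSteps) dWaveFormFactor 0‖ + 1) *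
        dWaveOrderParameterTT' t' U μ := by
  classical
  set X : Finset (Site 2) := pairRegion (insert (0 : Site 2) unitSteps) 0 with hX
  set B : FermionOp X := localPairAt (insert (0 : Site 2) unitSteps) dWaveFormFactor 0 with hB
  set A : FermionOp X := Bᴴ with hA
  have hBe : parityAut B = B := parityAut_localPairAt _ _ _
  -- Hermitian parts
  set H₁ : FermionOp X := (1 / 2 : ℂ) • (B + Bᴴ) with hH₁
  set H₂ : FermionOp X := (-Complex.I / 2) • (B - Bᴴ) with hH₂
  have hBh : parityAut Bᴴ = Bᴴ := by rw [parityAut_conjTranspose, hBe]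
  have hH₁e : parityAut H₁ = H₁ := by rw [hH₁, map_smul, map_add, hBe, hBh]
  have hH₂e : parityAut H₂ = H₂ := by rw [hH₂, map_smul, map_sub, hBe, hBh]
  have hH₁h : H₁.IsHermitian := by
    rw [hH₁]
    exact (Matrix.isHermitian_add_transpose_self B).smul (by
      rw [show (1 / 2 : ℂ) = ((1 / 2 : ℝ) : ℂ) by push_cast; ring, IsSelfAdjoint, Complex.star_def,
        Complex.conj_ofReal])
  have hH₂h : H₂.IsHermitian := by
    have hstar : star (-Complex.I / 2) = - (-Complex.I / 2) := by
      rw [Complex.star_def, map_div₀, map_neg, Complex.conj_I, neg_neg, neg_div, neg_neg, map_ofNat]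
    rw [Matrix.IsHermitian, hH₂, conjTranspose_smul, conjTranspose_sub, conjTranspose_conjTranspose, hstar,
      neg_smul, ← smul_neg, neg_sub]
  have hdec : H₁ + Complex.I • H₂ = B := by
    rw [hH₁, hH₂, smul_smul, show Complex.I * (-Complex.I / 2) = 1 / 2 by
      rw [mul_div_assoc', mul_neg, Complex.I_mul_I, neg_neg]]
    module
  -- norms of the parts
  have hnB : ‖Bᴴ‖ = ‖B‖ := by rw [← Matrix.star_eq_conjTranspose, norm_star]
  have hhalf : ‖(1 / 2 : ℂ)‖ = 1 / 2 := by
    rw [show (1 / 2 : ℂ) = ((1 / 2 : ℝ) : ℂ) by push_cast; ring, Complex.norm_real, Real.norm_eq_abs,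
      abs_of_pos (by norm_num : (0 : ℝ) < 1 / 2)]
  have hhalf' : ‖(-Complex.I / 2 : ℂ)‖ = 1 / 2 := by
    rw [norm_div, norm_neg, Complex.norm_I, Complex.norm_two]
  have hn₁ : ‖H₁‖ ≤ ‖B‖ := by
    rw [hH₁, norm_smul, hhalf]
    linarith [norm_add_le B Bᴴ]
  have hn₂ : ‖H₂‖ ≤ ‖B‖ := by
    rw [hH₂, norm_smul, hhalf']
    linarith [norm_sub_le B Bᴴ]
  clear_value H₁ H₂
  -- the limits of the two Hermitian parts
  have h₁ := hω.norm_limUnder_boxPairAverage_le_of_isHermitian hH₁e hH₁h h𝒰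
  have h₂ := hω.norm_limUnder_boxPairAverage_le_of_isHermitian hH₂e hH₂h h𝒰
  have hL₁ := tendsto_limUnder_of_norm_le' 𝒰 (fun N => ω.norm_boxPairAverage_le N A H₁)
  have hL₂ := tendsto_limUnder_of_norm_le' 𝒰 (fun N => ω.norm_boxPairAverage_le N A H₂)
  have key : ∀ N : ℕ, (((N : ℂ) ^ 2) ^ 2)⁻¹ *
      ∑ x ∈ halfOpenBox 2 N, ∑ y ∈ halfOpenBox 2 N,
        ω.corr A (fermionEmbed (PolySite.shiftEmb (y - x) X) B) =
      (((N : ℂ) ^ 2) ^ 2)⁻¹ *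
        ∑ x ∈ halfOpenBox 2 N, ∑ y ∈ halfOpenBox 2 N,
          ω.corr A (fermionEmbed (PolySite.shiftEmb (y - x) X) H₁) +
      Complex.I * ((((N : ℂ) ^ 2) ^ 2)⁻¹ *
        ∑ x ∈ halfOpenBox 2 N, ∑ y ∈ halfOpenBox 2 N,
          ω.corr A (fermionEmbed (PolySite.shiftEmb (y - x) X) H₂)) := by
    intro N
    rw [← hdec, corr_shift_add, corr_shift_smul]
    ring
  have hlim := ((hL₁.add (hL₂.const_mul Complex.I)).congr fun N => (key N).symm).limUnder_eq
  rw [hlim]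
  have hm0 := dWaveOrderParameterTT'_nonneg t' U μ
  calc ‖limUnder (𝒰 : Filter ℕ) (fun N => (((N : ℂ) ^ 2) ^ 2)⁻¹ *
            ∑ x ∈ halfOpenBox 2 N, ∑ y ∈ halfOpenBox 2 N,
              ω.corr A (fermionEmbed (PolySite.shiftEmb (y - x) X) H₁)) +
          Complex.I * limUnder (𝒰 : Filter ℕ) (fun N => (((N : ℂ) ^ 2) ^ 2)⁻¹ *
            ∑ x ∈ halfOpenBox 2 N, ∑ y ∈ halfOpenBox 2 N,
              ω.corr A (fermionEmbed (PolySite.shiftEmb (y - x) X) H₂))‖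
      ≤ 3 / 2 * (4 * ‖H₁‖ + 1) * dWaveOrderParameterTT' t' U μ +
          3 / 2 * (4 * ‖H₂‖ + 1) * dWaveOrderParameterTT' t' U μ := by
        refine (norm_add_le _ _).trans (add_le_add h₁ ?_)
        rw [norm_mul, Complex.norm_I, one_mul]
        exact h₂
    _ ≤ 3 / 2 * (4 * ‖B‖ + 1) * dWaveOrderParameterTT' t' U μ +
          3 / 2 * (4 * ‖B‖ + 1) * dWaveOrderParameterTT' t' U μ := by
        gcongr
    _ = 3 * (4 * ‖B‖ + 1) * dWaveOrderParameterTT' t' U μ := by ring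

/-- The pair two-point function at `(0, z)` as the Fejér summand `ω(P₀⋆ · τ_z P₀)`. [cite: Sewell1970, §4] -/
private theorem corr_localPairAt_conjTranspose_shiftEmb' (ω : InfVolFermionState 2) (S : Finset (Site 2))
    (g : Site 2 → ℝ) (z : Site 2) :
    ω.corr (localPairAt S g 0)ᴴ (fermionEmbed (PolySite.shiftEmb z (pairRegion S 0)) (localPairAt S g 0)) =
      ω.pairCorr S g 0 z := by
  rw [fermionEmbed_shiftEmb_localPairAt, corr_fermionEmbed_incl_right, pairCorr, zero_add]

/-- For a translation-invariant state the `d`-wave box average is the Fejér average of `ω(P₀⋆ · τ_z P₀)`.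
[cite: Sewell1970, §4] -/
theorem IsTranslationInvariant.boxAverage_dWavePairCorr_eq {ω : InfVolFermionState 2}
    (hω : ω.IsTranslationInvariant) (N : ℕ) :
    ((N : ℂ) ^ 4)⁻¹ * ∑ x ∈ halfOpenBox 2 N, ∑ y ∈ halfOpenBox 2 N, ω.dWavePairCorr x y =
      (((N : ℂ) ^ 2) ^ 2)⁻¹ * ∑ x ∈ halfOpenBox 2 N, ∑ y ∈ halfOpenBox 2 N,
        ω.corr (localPairAt (insert (0 : Site 2) unitSteps) dWaveFormFactor 0)ᴴ
          (fermionEmbed (PolySite.shiftEmb (y - x) (pairRegion (insert (0 : Site 2) unitSteps) 0))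
            (localPairAt (insert (0 : Site 2) unitSteps) dWaveFormFactor 0)) := by
  rw [show ((N : ℂ) ^ 2) ^ 2 = (N : ℂ) ^ 4 by rw [← pow_mul]]
  refine congrArg _ (sum_congr rfl fun x _ => sum_congr rfl fun y _ => ?_)
  rw [corr_localPairAt_conjTranspose_shiftEmb', ← hω.pairCorr_eq_pairCorr_zero]
  rfl

/-- **THE LINEAR LRO CEILING FOR EVERY TRANSLATION-INVARIANT GROUND STATE**: for every translation-invariant
ground state `ω` of the grand-canonical `t–t'` Hubbard interaction and every `ε > 0`, eventually
`|N⁻⁴ Σ_{x,y∈[0,N)²} ω(P_x⋆ P_y)| ≤ 3(4‖P₀‖ + 1)·m⋆ + ε`.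
[cite: KomaTasaki1994, §2.5] -/
theorem IsMeanEnergyMinimiser.eventually_norm_boxAverage_dWavePairCorr_le {ω : InfVolFermionState 2}
    (hω : ω.IsMeanEnergyMinimiser (hubbardTTPrimeMuInteraction 1 t' U μ) 1) {ε : ℝ} (hε : 0 < ε) :
    ∀ᶠ N : ℕ in atTop,
      ‖((N : ℂ) ^ 4)⁻¹ * ∑ x ∈ halfOpenBox 2 N, ∑ y ∈ halfOpenBox 2 N, ω.dWavePairCorr x y‖ ≤
        3 * (4 * ‖localPairAt (insert (0 : Site 2) unitSteps) dWaveFormFactor 0‖ + 1) *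
          dWaveOrderParameterTT' t' U μ + ε := by
  simp_rw [hω.1.boxAverage_dWavePairCorr_eq]
  exact eventually_norm_le_of_forall_ultrafilter (fun N => ω.norm_boxPairAverage_le N _ _)
    (fun 𝒰 h𝒰 => hω.norm_limUnder_boxPairAverage_localPairAt_le h𝒰) hε

/-- **NO RESPONSE ⇒ NO ODLRO**: if the quasi-average `d`-wave order parameter vanishes (`m⋆ = 0`), then EVERY
translation-invariant ground state of the `t–t'` Hubbard interaction has `N⁻⁴ Σ_{x,y∈[0,N)²} ω(P_x⋆ P_y) → 0`
— no `d`-wave off-diagonal long-range order in any translation-invariant infinite-volume ground state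
(the contrapositive, infinite-volume form of Koma–Tasaki's «LRO ⇒ symmetry breaking»).
[cite: KomaTasaki1994, §2.5] -/
theorem IsMeanEnergyMinimiser.tendsto_boxAverage_dWavePairCorr_of_not_hasDWaveOrderTT'
    {ω : InfVolFermionState 2} (hω : ω.IsMeanEnergyMinimiser (hubbardTTPrimeMuInteraction 1 t' U μ) 1)
    (h0 : ¬ HasDWaveOrderTT' t' U μ) :
    Tendsto (fun N : ℕ => ((N : ℂ) ^ 4)⁻¹ *
        ∑ x ∈ halfOpenBox 2 N, ∑ y ∈ halfOpenBox 2 N, ω.dWavePairCorr x y) atTop (𝓝 0) := by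
  have hm : dWaveOrderParameterTT' t' U μ = 0 :=
    le_antisymm (not_lt.1 h0) (dWaveOrderParameterTT'_nonneg t' U μ)
  refine squeeze_zero_norm' (a := fun n : ℕ => ‖((n : ℂ) ^ 4)⁻¹ *
      ∑ x ∈ halfOpenBox 2 n, ∑ y ∈ halfOpenBox 2 n, ω.dWavePairCorr x y‖)
    (Filter.Eventually.of_forall fun N => le_rfl) ?_
  rw [Metric.tendsto_atTop]
  intro ε hε
  obtain ⟨N₀, hN₀⟩ := eventually_atTop.1 (hω.eventually_norm_boxAverage_dWavePairCorr_le (half_pos hε))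
  refine ⟨N₀, fun N hN => ?_⟩
  have h := hN₀ N hN
  rw [hm, mul_zero, zero_add] at h
  rw [Real.dist_eq, sub_zero, abs_of_nonneg (norm_nonneg _)]
  linarith

/-- **RESPONSE ⇔ LONG-RANGE ORDER in the infinite-volume translation-invariant class.** The quasi-average
`d`-wave order parameter of the `t–t'` Hubbard model is strictly positive iff SOME translation-invariant ground
state of the grand-canonical interaction has `d`-wave off-diagonal long-range order (box averages of the pair
two-point function eventually `≥ c > 0`). Forward: Koma–Tasaki's gauge-invariant quasi-average ground state has
box pair LRO `≥ (m⋆)²` (`DWaveSymmetricGroundStateLRO.lean`); backward: the linear ceiling.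
[cite: KomaTasaki1994, §2.5] -/
theorem hasDWaveOrderTT'_iff_exists_isMeanEnergyMinimiser_odlro (t' U μ : ℝ) :
    HasDWaveOrderTT' t' U μ ↔
      ∃ ω : InfVolFermionState 2, ω.IsMeanEnergyMinimiser (hubbardTTPrimeMuInteraction 1 t' U μ) 1 ∧
        ∃ c : ℝ, 0 < c ∧ ∀ᶠ N : ℕ in atTop,
          c ≤ (((N : ℂ) ^ 4)⁻¹ * ∑ x ∈ halfOpenBox 2 N, ∑ y ∈ halfOpenBox 2 N, ω.dWavePairCorr x y).re := by
  constructor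
  · intro h
    obtain ⟨ω, hω, -, -, hlro⟩ :=
      exists_gaugeInvariant_isMeanEnergyMinimiser_dWaveOrderParameterTT'_sq_le_re_boxAverage t' U μ
    refine ⟨ω, hω, dWaveOrderParameterTT' t' U μ ^ 2, pow_pos h 2, ?_⟩
    filter_upwards [eventually_ne_atTop 0] with N hN
    exact hlro N hN
  · rintro ⟨ω, hω, c, hc, hlro⟩
    set C : ℝ := 3 * (4 * ‖localPairAt (insert (0 : Site 2) unitSteps) dWaveFormFactor 0‖ + 1) with hC
    have hCpos : 0 < C := by rw [hC]; positivity
    -- `c ≤ C m⋆ + ε` for every `ε > 0`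
    have hle : ∀ ε : ℝ, 0 < ε → c ≤ C * dWaveOrderParameterTT' t' U μ + ε := by
      intro ε hε
      obtain ⟨N, hN1, hN2⟩ := (hlro.and (hω.eventually_norm_boxAverage_dWavePairCorr_le hε)).exists
      exact hN1.trans ((Complex.re_le_norm _).trans hN2)
    have hcle : c ≤ C * dWaveOrderParameterTT' t' U μ :=
      le_of_forall_pos_le_add fun ε hε => hle ε hε
    by_contra hnot
    have hm : dWaveOrderParameterTT' t' U μ = 0 :=
      le_antisymm (not_lt.1 hnot) (dWaveOrderParameterTT'_nonneg t' U μ)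
    rw [hm, mul_zero] at hcle
    linarith

end Ceiling

/-! ### General interactions: the linear ceiling from ANY a-priori bound on ground-state pair amplitudes,
### and the positive-field (`h > 0`) form -/

section General

open scoped Matrix.Norms.L2Operator

variable {Ψ : FermionInteraction 2} {b : ℝ}

/-- **Step 1, general interaction.** If every translation-invariant ground state `ψ` of `Ψ` has
`‖ψ(P₀⋆)‖ ≤ b`, then for a ground state `ω` of `Ψ`, an even `B` with `0 ⪯ B ⪯ 𝟙`, `0 < ω(B) < 1`, and every
ultrafilter `𝒰 ≥ atTop`: `‖lim_𝒰 N⁻⁴Σ_{x,y} ω(P₀⋆ · τ_{y−x} B)‖ ≤ b` (the Fejér limit state is a ground state, by the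
face property of the minimisers). [cite: BratteliRobinsonI1987, §4.3.1 (PDF p. 373)] -/
theorem IsMeanEnergyMinimiser.norm_limUnder_boxPairAverage_le_of_forall {ω : InfVolFermionState 2}
    (hω : ω.IsMeanEnergyMinimiser Ψ 1)
    (hb : ∀ ψ : InfVolFermionState 2, ψ.IsMeanEnergyMinimiser Ψ 1 →
      ‖ψ.expect (pairRegion (insert (0 : Site 2) unitSteps) 0)
        (localPairAt (insert (0 : Site 2) unitSteps) dWaveFormFactor 0)ᴴ‖ ≤ b)
    {X : Finset (Site 2)} {B : FermionOp X} (hB : parityAut B = B) (hB0 : B.PosSemidef)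
    (hB1 : (1 - B).PosSemidef) (hω0 : 0 < (ω.expect X B).re) (hω1 : (ω.expect X B).re < 1)
    {𝒰 : Ultrafilter ℕ} (h𝒰 : (𝒰 : Filter ℕ) ≤ atTop) :
    ‖limUnder (𝒰 : Filter ℕ) (fun N => (((N : ℂ) ^ 2) ^ 2)⁻¹ *
        ∑ x ∈ halfOpenBox 2 N, ∑ y ∈ halfOpenBox 2 N,
          ω.corr (localPairAt (insert (0 : Site 2) unitSteps) dWaveFormFactor 0)ᴴ
            (fermionEmbed (PolySite.shiftEmb (y - x) X) B))‖ ≤ b := by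
  classical
  have hωTI := hω.1
  set m₁ : ℝ := (ω.expect X B).re with hm₁
  have hmB : ω.expect X B = (m₁ : ℂ) :=
    Complex.ext (by rw [Complex.ofReal_re]) (by
      rw [Complex.ofReal_im]; exact ω.expect_im_eq_zero_of_isHermitian hB0.1)
  have hB' : parityAut (1 - B) = 1 - B := by rw [map_sub, map_one, hB]
  have hmB' : ω.expect X (1 - B) = ((1 - m₁ : ℝ) : ℂ) := by
    rw [map_sub, ω.expect_one, hmB]; push_cast; ring
  obtain ⟨ψ₁, hψ₁TI, hψ₁e⟩ :=
    hωTI.exists_limitState_boxPairAverage (by norm_num : 0 < 2) hB hB0 hω0 hmB 𝒰 h𝒰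
  obtain ⟨ψ₂, hψ₂TI, hψ₂e⟩ :=
    hωTI.exists_limitState_boxPairAverage (by norm_num : 0 < 2) hB' hB1 (by linarith : 0 < 1 - m₁) hmB' 𝒰 h𝒰
  have hmix : InfVolFermionState.mix m₁ hω0.le (by linarith) ψ₁ ψ₂ = ω := by
    refine mix_eq_of_limitStates hω0 (by linarith : 0 < 1 - m₁) (by ring) h𝒰 hψ₁e hψ₂e
      (fun Λ A => ⟨‖A‖ * ‖B‖, fun N => ω.norm_boxPairAverage_le N A B⟩)
      (fun Λ A => ⟨‖A‖ * ‖1 - B‖, fun N => ω.norm_boxPairAverage_le N A (1 - B)⟩) ?_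
    intro Λ A
    filter_upwards [eventually_ne_atTop 0] with N hN
    have hc : ((N : ℂ) ^ 2) ^ 2 ≠ 0 := pow_ne_zero _ (pow_ne_zero _ (Nat.cast_ne_zero.2 hN))
    rw [← mul_add, corr_shift_sub, add_sub_cancel, corr_shift_one, ← mul_assoc, inv_mul_cancel₀ hc, one_mul]
  have hψ₁gs : ψ₁.IsMeanEnergyMinimiser Ψ 1 :=
    IsMeanEnergyMinimiser.of_mix_left hω0 hψ₁TI hψ₂TI (hmix.symm ▸ hω)
  have hm₁0 : (m₁ : ℂ) ≠ 0 := Complex.ofReal_ne_zero.2 hω0.ne'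
  have hlim : limUnder (𝒰 : Filter ℕ) (fun N => (((N : ℂ) ^ 2) ^ 2)⁻¹ *
      ∑ x ∈ halfOpenBox 2 N, ∑ y ∈ halfOpenBox 2 N,
        ω.corr (localPairAt (insert (0 : Site 2) unitSteps) dWaveFormFactor 0)ᴴ
          (fermionEmbed (PolySite.shiftEmb (y - x) X) B)) =
      (m₁ : ℂ) * ψ₁.expect _ (localPairAt (insert (0 : Site 2) unitSteps) dWaveFormFactor 0)ᴴ := by
    rw [hψ₁e, mul_inv_cancel_left₀ hm₁0]
  have hb0 : 0 ≤ b := (norm_nonneg _).trans (hb ψ₁ hψ₁gs)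
  rw [hlim, norm_mul, Complex.norm_real, Real.norm_eq_abs, abs_of_pos hω0]
  calc m₁ * ‖ψ₁.expect _ (localPairAt (insert (0 : Site 2) unitSteps) dWaveFormFactor 0)ᴴ‖
      ≤ 1 * b := mul_le_mul hω1.le (hb ψ₁ hψ₁gs) (norm_nonneg _) zero_le_one
    _ = b := one_mul _

/-- **Step 2, general interaction** (even Hermitian `H`): `‖lim_𝒰 N⁻⁴Σ ω(P₀⋆ · τ_{y−x} H)‖ ≤ (3/2)(4‖H‖+1)·b`.
[cite: BratteliRobinsonI1987, §4.3.1 (PDF p. 373)] -/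
theorem IsMeanEnergyMinimiser.norm_limUnder_boxPairAverage_le_of_forall_of_isHermitian
    {ω : InfVolFermionState 2} (hω : ω.IsMeanEnergyMinimiser Ψ 1)
    (hb : ∀ ψ : InfVolFermionState 2, ψ.IsMeanEnergyMinimiser Ψ 1 →
      ‖ψ.expect (pairRegion (insert (0 : Site 2) unitSteps) 0)
        (localPairAt (insert (0 : Site 2) unitSteps) dWaveFormFactor 0)ᴴ‖ ≤ b)
    {X : Finset (Site 2)} {H : FermionOp X} (hH : parityAut H = H) (hHh : H.IsHermitian)
    {𝒰 : Ultrafilter ℕ} (h𝒰 : (𝒰 : Filter ℕ) ≤ atTop) :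
    ‖limUnder (𝒰 : Filter ℕ) (fun N => (((N : ℂ) ^ 2) ^ 2)⁻¹ *
        ∑ x ∈ halfOpenBox 2 N, ∑ y ∈ halfOpenBox 2 N,
          ω.corr (localPairAt (insert (0 : Site 2) unitSteps) dWaveFormFactor 0)ᴴ
            (fermionEmbed (PolySite.shiftEmb (y - x) X) H))‖ ≤ 3 / 2 * (4 * ‖H‖ + 1) * b := by
  classical
  set A : FermionOp (pairRegion (insert (0 : Site 2) unitSteps) 0) :=
    (localPairAt (insert (0 : Site 2) unitSteps) dWaveFormFactor 0)ᴴ with hA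
  have hb0 : 0 ≤ b := (norm_nonneg _).trans (hb ω hω)
  set r : ℝ := (4 * ‖H‖ + 1)⁻¹ with hr
  have hr0 : 0 < r := by rw [hr]; positivity
  have hrC : (r : ℂ) ≠ 0 := Complex.ofReal_ne_zero.2 hr0.ne'
  set K : FermionOp X := (r : ℂ) • H with hK
  have hKh : K.IsHermitian := hHh.smul (by rw [IsSelfAdjoint, Complex.star_def, Complex.conj_ofReal])
  have hKn : ‖K‖ ≤ 1 / 4 := by
    rw [hK, norm_smul, Complex.norm_real, Real.norm_eq_abs, abs_of_pos hr0, hr]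
    rw [inv_mul_le_iff₀ (by positivity)]
    linarith [norm_nonneg H]
  set B' : FermionOp X := ((1 / 2 : ℝ) : ℂ) • (1 : FermionOp X) + K with hB'
  have hB'even : parityAut B' = B' := by
    rw [hB', map_add, map_smul, map_one, hK, map_smul, hH]
  have hdec1 : B' = ((1 / 2 - ‖K‖ : ℝ) : ℂ) • (1 : FermionOp X) + ((‖K‖ : ℂ) • 1 + K) := by
    rw [hB']
    push_cast
    module
  have hdec2 : 1 - B' = ((1 / 2 - ‖K‖ : ℝ) : ℂ) • (1 : FermionOp X) + ((‖K‖ : ℂ) • 1 - K) := by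
    rw [hB']
    push_cast
    module
  have hcoef : (0 : ℂ) ≤ ((1 / 2 - ‖K‖ : ℝ) : ℂ) := Complex.zero_le_real.2 (by linarith)
  have hB'0 : B'.PosSemidef := by
    rw [hdec1]; exact (Matrix.PosSemidef.one.smul hcoef).add (posSemidef_norm_smul_one_add' hKh)
  have hB'1 : (1 - B').PosSemidef := by
    rw [hdec2]; exact (Matrix.PosSemidef.one.smul hcoef).add (posSemidef_norm_smul_one_sub' hKh)
  have hωB' : ω.expect X B' = (1 / 2 : ℂ) + (r : ℂ) * ω.expect X H := by
    rw [hB', map_add, map_smul, ω.expect_one, hK, map_smul, smul_eq_mul, mul_one, smul_eq_mul]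
    push_cast
    ring
  have hωK : ‖(r : ℂ) * ω.expect X H‖ ≤ 1 / 4 := by
    have h := ω.norm_expect_le X K
    rw [hK, map_smul, smul_eq_mul] at h
    exact h.trans hKn
  have hre : (ω.expect X B').re = 1 / 2 + ((r : ℂ) * ω.expect X H).re := by
    rw [hωB', Complex.add_re]; norm_num
  have habs := (Complex.abs_re_le_norm ((r : ℂ) * ω.expect X H)).trans hωK
  have hω0 : 0 < (ω.expect X B').re := by
    rw [hre]; linarith [neg_abs_le ((r : ℂ) * ω.expect X H).re]
  have hω1 : (ω.expect X B').re < 1 := by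
    rw [hre]; linarith [le_abs_self ((r : ℂ) * ω.expect X H).re]
  have h1 := hω.norm_limUnder_boxPairAverage_le_of_forall hb hB'even hB'0 hB'1 hω0 hω1 h𝒰
  have hLB' := tendsto_limUnder_of_norm_le' 𝒰 (fun N => ω.norm_boxPairAverage_le N A B')
  have hL1 : Tendsto (fun N : ℕ => (((N : ℂ) ^ 2) ^ 2)⁻¹ *
      ∑ x ∈ halfOpenBox 2 N, ∑ y ∈ halfOpenBox 2 N,
        ω.corr A (fermionEmbed (PolySite.shiftEmb (y - x) X) (1 : FermionOp X))) (𝒰 : Filter ℕ)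
      (𝓝 (ω.expect _ A)) := by
    refine (tendsto_const_nhds.mono_left h𝒰).congr' ?_
    filter_upwards [h𝒰 (eventually_ne_atTop 0)] with N hN
    have hc : ((N : ℂ) ^ 2) ^ 2 ≠ 0 := pow_ne_zero _ (pow_ne_zero _ (Nat.cast_ne_zero.2 hN))
    rw [corr_shift_one, ← mul_assoc, inv_mul_cancel₀ hc, one_mul]
  have key : ∀ N : ℕ, (((N : ℂ) ^ 2) ^ 2)⁻¹ *
      ∑ x ∈ halfOpenBox 2 N, ∑ y ∈ halfOpenBox 2 N,
        ω.corr A (fermionEmbed (PolySite.shiftEmb (y - x) X) H) =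
      (r : ℂ)⁻¹ * ((((N : ℂ) ^ 2) ^ 2)⁻¹ *
        ∑ x ∈ halfOpenBox 2 N, ∑ y ∈ halfOpenBox 2 N,
          ω.corr A (fermionEmbed (PolySite.shiftEmb (y - x) X) B') -
        (1 / 2 : ℂ) * ((((N : ℂ) ^ 2) ^ 2)⁻¹ *
          ∑ x ∈ halfOpenBox 2 N, ∑ y ∈ halfOpenBox 2 N,
            ω.corr A (fermionEmbed (PolySite.shiftEmb (y - x) X) (1 : FermionOp X)))) := by
    intro N
    rw [hB', corr_shift_add, corr_shift_smul, hK, corr_shift_smul]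
    push_cast
    field_simp
    ring
  have hlimH : Tendsto (fun N : ℕ => (((N : ℂ) ^ 2) ^ 2)⁻¹ *
      ∑ x ∈ halfOpenBox 2 N, ∑ y ∈ halfOpenBox 2 N,
        ω.corr A (fermionEmbed (PolySite.shiftEmb (y - x) X) H)) (𝒰 : Filter ℕ)
      (𝓝 ((r : ℂ)⁻¹ * (limUnder (𝒰 : Filter ℕ) (fun N => (((N : ℂ) ^ 2) ^ 2)⁻¹ *
        ∑ x ∈ halfOpenBox 2 N, ∑ y ∈ halfOpenBox 2 N,
          ω.corr A (fermionEmbed (PolySite.shiftEmb (y - x) X) B')) - (1 / 2 : ℂ) * ω.expect _ A))) :=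
    ((hLB'.sub (hL1.const_mul (1 / 2 : ℂ))).const_mul (r : ℂ)⁻¹).congr fun N => (key N).symm
  rw [hlimH.limUnder_eq, norm_mul, norm_inv, Complex.norm_real, Real.norm_eq_abs, abs_of_pos hr0, hr, inv_inv]
  have hA' : ‖ω.expect _ A‖ ≤ b := hb ω hω
  calc (4 * ‖H‖ + 1) * ‖limUnder (𝒰 : Filter ℕ) (fun N => (((N : ℂ) ^ 2) ^ 2)⁻¹ *
          ∑ x ∈ halfOpenBox 2 N, ∑ y ∈ halfOpenBox 2 N,
            ω.corr A (fermionEmbed (PolySite.shiftEmb (y - x) X) B')) - (1 / 2 : ℂ) * ω.expect _ A‖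
      ≤ (4 * ‖H‖ + 1) * (b + 1 / 2 * b) := by
        refine mul_le_mul_of_nonneg_left ((norm_sub_le _ _).trans (add_le_add h1 ?_)) (by positivity)
        rw [norm_mul]
        exact mul_le_mul (by norm_num) hA' (norm_nonneg _) (by norm_num)
    _ = 3 / 2 * (4 * ‖H‖ + 1) * b := by ring

/-- **Step 3, general interaction** (the pair operator, `P₀ = H₁ + iH₂`):
`‖lim_𝒰 N⁻⁴Σ ω(P₀⋆ · τ_{y−x} P₀)‖ ≤ 3(4‖P₀‖+1)·b`. [cite: BratteliRobinsonI1987, §4.3.1 (PDF p. 373)] -/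
theorem IsMeanEnergyMinimiser.norm_limUnder_boxPairAverage_localPairAt_le_of_forall
    {ω : InfVolFermionState 2} (hω : ω.IsMeanEnergyMinimiser Ψ 1)
    (hb : ∀ ψ : InfVolFermionState 2, ψ.IsMeanEnergyMinimiser Ψ 1 →
      ‖ψ.expect (pairRegion (insert (0 : Site 2) unitSteps) 0)
        (localPairAt (insert (0 : Site 2) unitSteps) dWaveFormFactor 0)ᴴ‖ ≤ b)
    {𝒰 : Ultrafilter ℕ} (h𝒰 : (𝒰 : Filter ℕ) ≤ atTop) :
    ‖limUnder (𝒰 : Filter ℕ) (fun N => (((N : ℂ) ^ 2) ^ 2)⁻¹ *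
        ∑ x ∈ halfOpenBox 2 N, ∑ y ∈ halfOpenBox 2 N,
          ω.corr (localPairAt (insert (0 : Site 2) unitSteps) dWaveFormFactor 0)ᴴ
            (fermionEmbed (PolySite.shiftEmb (y - x) (pairRegion (insert (0 : Site 2) unitSteps) 0))
              (localPairAt (insert (0 : Site 2) unitSteps) dWaveFormFactor 0)))‖ ≤
      3 * (4 * ‖localPairAt (insert (0 : Site 2) unitSteps) dWaveFormFactor 0‖ + 1) * b := by
  classical
  set X : Finset (Site 2) := pairRegion (insert (0 : Site 2) unitSteps) 0 with hX
  set B : FermionOp X := localPairAt (insert (0 : Site 2) unitSteps) dWaveFormFactor 0 with hB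
  set A : FermionOp X := Bᴴ with hA
  have hb0 : 0 ≤ b := (norm_nonneg _).trans (hb ω hω)
  have hBe : parityAut B = B := parityAut_localPairAt _ _ _
  set H₁ : FermionOp X := (1 / 2 : ℂ) • (B + Bᴴ) with hH₁
  set H₂ : FermionOp X := (-Complex.I / 2) • (B - Bᴴ) with hH₂
  have hBh : parityAut Bᴴ = Bᴴ := by rw [parityAut_conjTranspose, hBe]
  have hH₁e : parityAut H₁ = H₁ := by rw [hH₁, map_smul, map_add, hBe, hBh]
  have hH₂e : parityAut H₂ = H₂ := by rw [hH₂, map_smul, map_sub, hBe, hBh]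
  have hH₁h : H₁.IsHermitian := by
    rw [hH₁]
    exact (Matrix.isHermitian_add_transpose_self B).smul (by
      rw [show (1 / 2 : ℂ) = ((1 / 2 : ℝ) : ℂ) by push_cast; ring, IsSelfAdjoint, Complex.star_def,
        Complex.conj_ofReal])
  have hH₂h : H₂.IsHermitian := by
    have hstar : star (-Complex.I / 2) = - (-Complex.I / 2) := by
      rw [Complex.star_def, map_div₀, map_neg, Complex.conj_I, neg_neg, neg_div, neg_neg, map_ofNat]
    rw [Matrix.IsHermitian, hH₂, conjTranspose_smul, conjTranspose_sub, conjTranspose_conjTranspose, hstar,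
      neg_smul, ← smul_neg, neg_sub]
  have hdec : H₁ + Complex.I • H₂ = B := by
    rw [hH₁, hH₂, smul_smul, show Complex.I * (-Complex.I / 2) = 1 / 2 by
      rw [mul_div_assoc', mul_neg, Complex.I_mul_I, neg_neg]]
    module
  have hnB : ‖Bᴴ‖ = ‖B‖ := by rw [← Matrix.star_eq_conjTranspose, norm_star]
  have hhalf : ‖(1 / 2 : ℂ)‖ = 1 / 2 := by
    rw [show (1 / 2 : ℂ) = ((1 / 2 : ℝ) : ℂ) by push_cast; ring, Complex.norm_real, Real.norm_eq_abs,
      abs_of_pos (by norm_num : (0 : ℝ) < 1 / 2)]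
  have hhalf' : ‖(-Complex.I / 2 : ℂ)‖ = 1 / 2 := by
    rw [norm_div, norm_neg, Complex.norm_I, Complex.norm_two]
  have hn₁ : ‖H₁‖ ≤ ‖B‖ := by
    rw [hH₁, norm_smul, hhalf]
    linarith [norm_add_le B Bᴴ]
  have hn₂ : ‖H₂‖ ≤ ‖B‖ := by
    rw [hH₂, norm_smul, hhalf']
    linarith [norm_sub_le B Bᴴ]
  clear_value H₁ H₂
  have h₁ := hω.norm_limUnder_boxPairAverage_le_of_forall_of_isHermitian hb hH₁e hH₁h h𝒰
  have h₂ := hω.norm_limUnder_boxPairAverage_le_of_forall_of_isHermitian hb hH₂e hH₂h h𝒰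
  have hL₁ := tendsto_limUnder_of_norm_le' 𝒰 (fun N => ω.norm_boxPairAverage_le N A H₁)
  have hL₂ := tendsto_limUnder_of_norm_le' 𝒰 (fun N => ω.norm_boxPairAverage_le N A H₂)
  have key : ∀ N : ℕ, (((N : ℂ) ^ 2) ^ 2)⁻¹ *
      ∑ x ∈ halfOpenBox 2 N, ∑ y ∈ halfOpenBox 2 N,
        ω.corr A (fermionEmbed (PolySite.shiftEmb (y - x) X) B) =
      (((N : ℂ) ^ 2) ^ 2)⁻¹ *
        ∑ x ∈ halfOpenBox 2 N, ∑ y ∈ halfOpenBox 2 N,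
          ω.corr A (fermionEmbed (PolySite.shiftEmb (y - x) X) H₁) +
      Complex.I * ((((N : ℂ) ^ 2) ^ 2)⁻¹ *
        ∑ x ∈ halfOpenBox 2 N, ∑ y ∈ halfOpenBox 2 N,
          ω.corr A (fermionEmbed (PolySite.shiftEmb (y - x) X) H₂)) := by
    intro N
    rw [← hdec, corr_shift_add, corr_shift_smul]
    ring
  have hlim := ((hL₁.add (hL₂.const_mul Complex.I)).congr fun N => (key N).symm).limUnder_eq
  rw [hlim]
  calc ‖limUnder (𝒰 : Filter ℕ) (fun N => (((N : ℂ) ^ 2) ^ 2)⁻¹ *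
            ∑ x ∈ halfOpenBox 2 N, ∑ y ∈ halfOpenBox 2 N,
              ω.corr A (fermionEmbed (PolySite.shiftEmb (y - x) X) H₁)) +
          Complex.I * limUnder (𝒰 : Filter ℕ) (fun N => (((N : ℂ) ^ 2) ^ 2)⁻¹ *
            ∑ x ∈ halfOpenBox 2 N, ∑ y ∈ halfOpenBox 2 N,
              ω.corr A (fermionEmbed (PolySite.shiftEmb (y - x) X) H₂))‖
      ≤ 3 / 2 * (4 * ‖H₁‖ + 1) * b + 3 / 2 * (4 * ‖H₂‖ + 1) * b := by
        refine (norm_add_le _ _).trans (add_le_add h₁ ?_)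
        rw [norm_mul, Complex.norm_I, one_mul]
        exact h₂
    _ ≤ 3 / 2 * (4 * ‖B‖ + 1) * b + 3 / 2 * (4 * ‖B‖ + 1) * b := by gcongr
    _ = 3 * (4 * ‖B‖ + 1) * b := by ring

/-- **THE LINEAR LRO CEILING, general interaction**: if every translation-invariant ground state of `Ψ` has
`‖ψ(P₀⋆)‖ ≤ b`, then every translation-invariant ground state `ω` of `Ψ` has, for every `ε > 0`, eventually
`|N⁻⁴ Σ_{x,y∈[0,N)²} ω(P_x⋆ P_y)| ≤ 3(4‖P₀‖+1)·b + ε`. [cite: KomaTasaki1994, §2.5] -/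
theorem IsMeanEnergyMinimiser.eventually_norm_boxAverage_dWavePairCorr_le_of_forall
    {ω : InfVolFermionState 2} (hω : ω.IsMeanEnergyMinimiser Ψ 1)
    (hb : ∀ ψ : InfVolFermionState 2, ψ.IsMeanEnergyMinimiser Ψ 1 →
      ‖ψ.expect (pairRegion (insert (0 : Site 2) unitSteps) 0)
        (localPairAt (insert (0 : Site 2) unitSteps) dWaveFormFactor 0)ᴴ‖ ≤ b) {ε : ℝ} (hε : 0 < ε) :
    ∀ᶠ N : ℕ in atTop,
      ‖((N : ℂ) ^ 4)⁻¹ * ∑ x ∈ halfOpenBox 2 N, ∑ y ∈ halfOpenBox 2 N, ω.dWavePairCorr x y‖ ≤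
        3 * (4 * ‖localPairAt (insert (0 : Site 2) unitSteps) dWaveFormFactor 0‖ + 1) * b + ε := by
  simp_rw [hω.1.boxAverage_dWavePairCorr_eq]
  exact eventually_norm_le_of_forall_ultrafilter (fun N => ω.norm_boxPairAverage_le N _ _)
    (fun 𝒰 h𝒰 => hω.norm_limUnder_boxPairAverage_localPairAt_le_of_forall hb h𝒰) hε

/-- **Positive field: every translation-invariant ground state of `Ψ_h`, `h > 0`, has `‖ψ(P₀⋆)‖ ≤ −∂⁺E(h)/2`**
(phase alignment `|ψ(P₀)| = Re ψ(P₀)` and the Griffiths bracket `2 Re ψ(P₀) ≤ −∂⁺E(h)`).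
[cite: Griffiths1966, §II] -/
theorem IsMeanEnergyMinimiser.norm_expect_localPairAt_conjTranspose_le_of_pos {t' U μ h : ℝ} (hh : 0 < h)
    {ψ : InfVolFermionState 2}
    (hψ : ψ.IsMeanEnergyMinimiser (hubbardTTPrimeSourcedInteraction 1 t' U μ dWaveFormFactor h) 1) :
    ‖ψ.expect (pairRegion (insert (0 : Site 2) unitSteps) 0)
        (localPairAt (insert (0 : Site 2) unitSteps) dWaveFormFactor 0)ᴴ‖ ≤
      -derivWithin (dWaveSourceEnergyDensityTT' t' U μ) (Ioi h) h / 2 := by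
  rw [expect_conjTranspose, norm_star, hψ.norm_expect_localPairAt_eq_re hh]
  have hup := hψ.two_mul_re_expect_localPairAt_mem_Icc.2
  linarith

/-- **THE LINEAR LRO CEILING AT `h > 0`**: every translation-invariant ground state `ω` of the pair-sourced
interaction `Ψ_h`, `h > 0`, has, for every `ε > 0`, eventually
`|N⁻⁴ Σ_{x,y∈[0,N)²} ω(P_x⋆ P_y)| ≤ 3(4‖P₀‖+1)·(−∂⁺E(h)/2) + ε` — the finite-field LRO word is bounded by a
multiple of the response word, for ALL translation-invariant ground states (the quadratic form
`(∂⁺E(h)/2)²` is proved for ergodic ones, `ErgodicGroundStatePairLROCeiling.lean`). [cite: KomaTasaki1994, §2.5] -/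
theorem IsMeanEnergyMinimiser.eventually_norm_boxAverage_dWavePairCorr_le_of_pos {t' U μ h : ℝ} (hh : 0 < h)
    {ω : InfVolFermionState 2}
    (hω : ω.IsMeanEnergyMinimiser (hubbardTTPrimeSourcedInteraction 1 t' U μ dWaveFormFactor h) 1)
    {ε : ℝ} (hε : 0 < ε) :
    ∀ᶠ N : ℕ in atTop,
      ‖((N : ℂ) ^ 4)⁻¹ * ∑ x ∈ halfOpenBox 2 N, ∑ y ∈ halfOpenBox 2 N, ω.dWavePairCorr x y‖ ≤
        3 * (4 * ‖localPairAt (insert (0 : Site 2) unitSteps) dWaveFormFactor 0‖ + 1) *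
          (-derivWithin (dWaveSourceEnergyDensityTT' t' U μ) (Ioi h) h / 2) + ε :=
  hω.eventually_norm_boxAverage_dWavePairCorr_le_of_forall
    (fun _ hψ => hψ.norm_expect_localPairAt_conjTranspose_le_of_pos hh) hε

end General

end InfVolFermionState

end Literature.MathematicalPhysics.QuantumLattice

end
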